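import Literature.NumberTheory.GaloisRepresentations.ArtinLFunctionDirichletProofs
import Literature.NumberTheory.GaloisRepresentations.FramedRepTwistEulerFactorProofs
import Literature.NumberTheory.GaloisRepresentations.KroneckerWeberTheorem
import Literature.NumberTheory.EllipticCurves.DeligneSerreWeightOneIrreducibleKroneckerWeberProofs
import HarnessLib

/-!
# Finite-order characters of `Γ_ℚ` are Dirichlet characters; conductor and ramification

Topic `Literature/NumberTheory/GaloisRepresentations`; namespace
`Literature.NumberTheory.GaloisRepresentations`.  THEOREMS ONLY (no definition, no named fact).

The dictionary between characters `ψ : Γ_ℚ = Gal(ℚ̄/ℚ) → ℂˣ` with open kernel and Dirichlet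
characters (Washington, *Cyclotomic Fields*, Ch. 3, pp. 19–21; Neukirch, *Algebraic Number
Theory*, VII (10.4)(ii) and I (10.3)–(10.4)):

* `unitsMap_modNCyclotomicCharacter` — compatibility of the mod `m` and mod `N` cyclotomic
  characters of the tree (`Literature.NumberTheory.GaloisRepresentations.modNCyclotomicCharacter`)
  for `N ∣ m`: `χ_m(σ) mod N = χ_N(σ)`.
* `exists_dirichletCharacter_eq_dirichletGaloisCharacter` — **every `ψ` with open kernel is
  `σ ↦ χ(χ_m(σ))` for a Dirichlet character `χ` modulo some `m`** (Kronecker–Weber, proved in the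
  tree as `KroneckerWeber_holds`, via `exists_forall_smul_eq_self_imp_eq_one_of_isKroneckerWeber`
  and the surjectivity of `χ_m`); i.e. `ψ = dirichletGaloisCharacter ℚ χ` pointwise.
* `exists_isPrimitive_dirichletCharacter_eq_dirichletGaloisCharacter` — the same with `χ`
  **primitive** (pass to `χ.primitiveCharacter` of conductor `N ∣ m` using the compatibility).
* `not_dvd_conductor_of_forall_mem_inertia` — **ramification is read off the conductor**: if
  `ψ = dirichletGaloisCharacter ℚ χ` with `χ` primitive of conductor `N`, and `ψ` is trivial on the
  inertia group `I_𝔓` of one prime `𝔓` of `ℤ̄` above `p`, then `p ∤ N`.  Proof: write the level as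
  `p^{k+1} d`, `p ∤ d`; every `a ≡ 1 (mod d)` is `χ_m(τ)` for some `τ ∈ I_𝔓` (tree
  `exists_mem_inertia_modNCyclotomicCharacter_eq`: `p` is totally ramified in `ℚ(ζ_{p^{k+1}})`,
  unramified in `ℚ(ζ_d)`, and inertia surjects onto inertia), so `χ(a) = ψ(τ) = 1`, `χ` factors
  through `d` (Mathlib `DirichletCharacter.factorsThrough_iff_ker_unitsMap`) and
  `cond χ ∣ d` (Mathlib `conductor_dvd_of_mem_conductorSet`).  Conversely
  `dirichletGaloisCharacter_eq_one_of_mem_inertia` (tree, `FramedRepTwistEulerFactorProofs`):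
  `p ∤ N ⇒ ψ(I_𝔓) = 1`.
* `exists_isPrimitive_dirichletCharacter_of_isOpen_ker` — packaged form used by
  Billerey–Menares §3.2 / Deligne–Serre 8.7: for `ψ` with open kernel, unramified at `p` (trivial
  on some `I_𝔓`, `𝔓 ∣ p`), there are `N ≥ 1` with `p ∤ N` and a primitive `χ` mod `N` with
  `ψ(σ) = χ(χ_N(σ))` for all `σ`; in particular `ψ(Frob_𝔏) = χ(ℓ)` for every prime `ℓ ∤ N` and
  every arithmetic Frobenius at a prime `𝔏 ∣ ℓ` of `ℤ̄` (tree
  `coe_dirichletGaloisCharacter_of_isArithFrobAt`), and `ψ(c) = χ(-1)` at complex conjugations.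

## References

* L. C. Washington, *Introduction to Cyclotomic Fields*, 2nd ed., GTM 83 (1997), Ch. 3
  (pp. 19–21: Dirichlet characters as characters of `Gal(ℚ(ζ_n)/ℚ)`, conductor `f_χ` and
  ramification: "`p` ramifies in the field of `χ` iff `p ∣ f_χ`"), Thm. 14.1. [Washington1997]
* J. Neukirch, *Algebraic Number Theory*, Grundlehren 322 (1999), Ch. I (10.3)–(10.4),
  Ch. VII (10.4) (ii). [NeukirchANT1999]
* N. Billerey, R. Menares, *Strong modularity of reducible Galois representations*, Trans. AMS
  370 (2018), §2.1 and §3.2 (the characters `ε₁, ε₂` "seen as Dirichlet characters").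
  [BillereyMenares2018]
-/

noncomputable section

open Field IsDedekindDomain NumberField Rat.HeightOneSpectrum

namespace Literature.NumberTheory.GaloisRepresentations

/-! ### Compatibility of the cyclotomic characters modulo `N ∣ m` -/

section Compatibility

variable (K : Type*) [Field K] {N m : ℕ} [NeZero N] [NeZero m] [NeZero (N : K)] [NeZero (m : K)]

/-- **`χ_m(σ) ≡ χ_N(σ) (mod N)` for `N ∣ m`**: a primitive `N`-th root of unity is an `m`-th root
of unity, and `χ_N` is characterised by the action on it. [folklore] -/
theorem unitsMap_modNCyclotomicCharacter (hNm : N ∣ m) (σ : absoluteGaloisGroup K) :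
    ZMod.unitsMap hNm (modNCyclotomicCharacter K m σ) = modNCyclotomicCharacter K N σ := by
  obtain ⟨ζ, hζ⟩ := HasEnoughRootsOfUnity.exists_primitiveRoot (AlgebraicClosure K) N
  have hζm : ζ ^ m = 1 := by
    obtain ⟨c, rfl⟩ := hNm
    rw [pow_mul, hζ.pow_eq_one, one_pow]
  have h := modNCyclotomicCharacter_eq_of_smul_eq_pow K N hζ σ
    (modNCyclotomicCharacter_spec K m σ ζ hζm)
  ext
  rw [ZMod.unitsMap_val, ZMod.cast_eq_val, h]

/-- The same, on values in `ZMod N`. [folklore] -/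
theorem cast_modNCyclotomicCharacter (hNm : N ∣ m) (σ : absoluteGaloisGroup K) :
    (ZMod.cast ((modNCyclotomicCharacter K m σ : (ZMod m)ˣ) : ZMod m) : ZMod N) =
      (modNCyclotomicCharacter K N σ : ZMod N) := by
  rw [← unitsMap_modNCyclotomicCharacter K hNm σ, ZMod.unitsMap_val]

/-- **Change of level for `dirichletGaloisCharacter`**: for `χ` modulo `N ∣ m`,
`dirichletGaloisCharacter (changeLevel χ) = dirichletGaloisCharacter χ` pointwise. [folklore] -/
theorem dirichletGaloisCharacter_changeLevel (hNm : N ∣ m) (χ : DirichletCharacter ℂ N)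
    (σ : absoluteGaloisGroup K) :
    ((dirichletGaloisCharacter K (DirichletCharacter.changeLevel hNm χ) σ : ℂˣ) : ℂ) =
      ((dirichletGaloisCharacter K χ σ : ℂˣ) : ℂ) := by
  rw [coe_dirichletGaloisCharacter_apply, coe_dirichletGaloisCharacter_apply,
    DirichletCharacter.changeLevel_eq_cast_of_dvd χ hNm, cast_modNCyclotomicCharacter K hNm]

end Compatibility

/-! ### Characters of `Γ_ℚ` with open kernel are Dirichlet characters -/

section Rat

/-- **Kronecker–Weber: a character `ψ : Γ_ℚ → ℂˣ` with open kernel is a Dirichlet character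
composed with a cyclotomic character**: `ψ(σ) = χ(χ_m(σ))` for some `m ≥ 1`, some Dirichlet
character `χ` modulo `m`, and all `σ ∈ Γ_ℚ` (`ψ` is trivial on `Gal(ℚ̄/ℚ(μ_m))`,
`exists_forall_smul_eq_self_imp_eq_one_of_isKroneckerWeber` with `KroneckerWeber_holds`, so it
factors through the surjection `χ_m : Γ_ℚ → (ℤ/m)ˣ`). [cite: Washington1997, Ch. 3 (p. 21) and Thm. 14.1] -/
theorem exists_dirichletCharacter_eq_dirichletGaloisCharacter (ψ : absoluteGaloisGroup ℚ →* ℂˣ)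
    (hker : IsOpen ((ψ.ker : Subgroup (absoluteGaloisGroup ℚ)) : Set (absoluteGaloisGroup ℚ))) :
    ∃ (m : ℕ) (_ : NeZero m) (χ : DirichletCharacter ℂ m),
      ∀ σ : absoluteGaloisGroup ℚ, (ψ σ : ℂ) = ((dirichletGaloisCharacter ℚ χ σ : ℂˣ) : ℂ) := by
  classical
  obtain ⟨m, hm, hfixm⟩ :=
    exists_forall_smul_eq_self_imp_eq_one_of_isKroneckerWeber KroneckerWeber_holds ψ hker
  haveI : NeZero m := ⟨hm.ne'⟩
  set c : absoluteGaloisGroup ℚ →* (ZMod m)ˣ := modNCyclotomicCharacter ℚ m with hcdef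
  -- `ker c ≤ ker ψ`
  have hle : c.ker ≤ ψ.ker := by
    intro σ hσ
    rw [MonoidHom.mem_ker] at hσ ⊢
    refine hfixm σ fun ζ hζ => ?_
    rw [modNCyclotomicCharacter_spec ℚ m σ ζ hζ, ← hcdef, hσ, Units.val_one]
    rcases Nat.lt_or_ge 1 m with h1 | h1
    · rw [ZMod.val_one'' h1.ne', pow_one]
    · have hm1 : m = 1 := le_antisymm h1 hm
      subst hm1
      rw [pow_one] at hζ
      rw [hζ, one_pow]
  -- factor `ψ = χ₀ ∘ c`
  have hsurj : Function.Surjective c := modNCyclotomicCharacter_rat_surjective m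
  have hs : Function.RightInverse (Function.surjInv hsurj) c := Function.rightInverse_surjInv hsurj
  set χ₀ : (ZMod m)ˣ →* ℂˣ := MonoidHom.liftOfRightInverse c (Function.surjInv hsurj) hs ⟨ψ, hle⟩
    with hχ₀
  have hχ₀c : ∀ σ, χ₀ (c σ) = ψ σ := fun σ =>
    MonoidHom.liftOfRightInverse_comp_apply c (Function.surjInv hsurj) hs ⟨ψ, hle⟩ σ
  refine ⟨m, inferInstance, MulChar.ofUnitHom χ₀, fun σ => ?_⟩
  rw [coe_dirichletGaloisCharacter_apply, ← hcdef, MulChar.ofUnitHom_coe, hχ₀c]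

/-- **The same with a primitive Dirichlet character** (replace `χ` by its associated primitive
character `χ.primitiveCharacter` of conductor `N ∣ m`; the two Galois characters agree by
`dirichletGaloisCharacter_changeLevel`). [cite: Washington1997, Ch. 3 (pp. 19–21)] -/
theorem exists_isPrimitive_dirichletCharacter_eq_dirichletGaloisCharacter
    (ψ : absoluteGaloisGroup ℚ →* ℂˣ)
    (hker : IsOpen ((ψ.ker : Subgroup (absoluteGaloisGroup ℚ)) : Set (absoluteGaloisGroup ℚ))) :
    ∃ (N : ℕ) (_ : NeZero N) (χ : DirichletCharacter ℂ N), χ.IsPrimitive ∧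
      ∀ σ : absoluteGaloisGroup ℚ, (ψ σ : ℂ) = ((dirichletGaloisCharacter ℚ χ σ : ℂˣ) : ℂ) := by
  obtain ⟨m, hm, χ, hχ⟩ := exists_dirichletCharacter_eq_dirichletGaloisCharacter ψ hker
  haveI : NeZero χ.conductor := ⟨χ.conductor_ne_zero⟩
  refine ⟨χ.conductor, inferInstance, χ.primitiveCharacter, χ.primitiveCharacter_isPrimitive,
    fun σ => ?_⟩
  rw [hχ σ, ← dirichletGaloisCharacter_changeLevel ℚ χ.conductor_dvd_level,
    DirichletCharacter.changeLevel_primitiveCharacter]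

end Rat

/-! ### Ramification and the conductor -/

section Conductor

/-- A finite place `v` of `ℚ` containing the rational prime `p` is the place of `p`. [folklore] -/
theorem natGenerator_eq_of_natCast_mem_asIdeal {v : HeightOneSpectrum (𝓞 ℚ)} {p : ℕ}
    (hp : p.Prime) (hv : (p : 𝓞 ℚ) ∈ v.asIdeal) : natGenerator v = p := by
  have h : natGenerator v ∣ p := by
    rw [natGenerator_dvd_iff, ← map_natCast (Rat.IsIntegralClosure.intEquiv (𝓞 ℚ)) p]
    exact Ideal.mem_map_of_mem _ hv
  exact (Nat.prime_dvd_prime_iff_eq (prime_natGenerator v) hp).mp h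

variable {m : ℕ} [NeZero m]

/-- **A Dirichlet character whose Galois character is unramified at `p` factors through the
prime-to-`p` part of its level**: if `χ(χ_m(τ)) = 1` for all `τ` in the inertia group of one
prime `𝔓 ∣ p` of `ℤ̄` and `m = p^{k+1} d`, `p ∤ d`, then `χ` factors through `d`
(every `a ≡ 1 (mod d)` is `χ_m(τ)` for some `τ ∈ I_𝔓`, tree
`exists_mem_inertia_modNCyclotomicCharacter_eq`). [cite: Washington1997, Ch. 3 (p. 21, Cor. 3.6 ff.)] -/
theorem factorsThrough_of_forall_mem_inertia (χ : DirichletCharacter ℂ m) {p k d : ℕ}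
    [Fact p.Prime] (hm : m = p ^ (k + 1) * d) (hd : ¬ p ∣ d) {v : HeightOneSpectrum (𝓞 ℚ)}
    (hv : natGenerator v = p) {𝔓 : Ideal (absIntegers (𝓞 ℚ) ℚ)} (h𝔓 : 𝔓 ∈ v.primesAbove)
    (hψ : ∀ τ ∈ 𝔓.inertia (absoluteGaloisGroup ℚ),
      ((dirichletGaloisCharacter ℚ χ τ : ℂˣ) : ℂ) = 1) :
    χ.FactorsThrough d := by
  rw [DirichletCharacter.factorsThrough_iff_ker_unitsMap (Dvd.intro_left _ hm.symm)]
  intro a ha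
  rw [MonoidHom.mem_ker] at ha ⊢
  obtain ⟨τ, hτ, hτa⟩ := exists_mem_inertia_modNCyclotomicCharacter_eq hm hd hv h𝔓 ha
  have h := hψ τ hτ
  rw [coe_dirichletGaloisCharacter_apply, hτa] at h
  ext
  rw [MulChar.coe_toUnitHom, h, Units.val_one]

/-- **Ramification is read off the conductor**: if the Galois character of a Dirichlet character
`χ` modulo `m` is trivial on the inertia group of one prime `𝔓` of `ℤ̄` above `p`, then `p` does
not divide the conductor of `χ` — so for `χ` primitive, `p ∤ m`.  (The converse,
`p ∤ m ⇒ χ(χ_m(I_𝔓)) = 1`, is `dirichletGaloisCharacter_eq_one_of_mem_inertia`.)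
[cite: Washington1997, Ch. 3 (pp. 19–21); NeukirchANT1999, Ch. I (10.3)–(10.4)] -/
theorem not_dvd_conductor_of_forall_mem_inertia (χ : DirichletCharacter ℂ m) {p : ℕ}
    (hp : p.Prime) {v : HeightOneSpectrum (𝓞 ℚ)} (hv : (p : 𝓞 ℚ) ∈ v.asIdeal)
    {𝔓 : Ideal (absIntegers (𝓞 ℚ) ℚ)} (h𝔓 : 𝔓 ∈ v.primesAbove)
    (hψ : ∀ τ ∈ 𝔓.inertia (absoluteGaloisGroup ℚ),
      ((dirichletGaloisCharacter ℚ χ τ : ℂˣ) : ℂ) = 1) :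
    ¬ p ∣ χ.conductor := by
  haveI : Fact p.Prime := ⟨hp⟩
  by_cases hpm : p ∣ m
  · -- `m = p^{k+1} d`, `p ∤ d`
    obtain ⟨e, d, hd, hm⟩ := Nat.exists_eq_pow_mul_and_not_dvd (NeZero.ne m) p hp.ne_one
    have he : e ≠ 0 := by
      rintro rfl
      rw [pow_zero, one_mul] at hm
      exact hd (hm ▸ hpm)
    obtain ⟨k, rfl⟩ := Nat.exists_eq_succ_of_ne_zero he
    have hfac := factorsThrough_of_forall_mem_inertia χ hm hd
      (natGenerator_eq_of_natCast_mem_asIdeal hp hv) h𝔓 hψ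
    have hcond : χ.conductor ∣ d :=
      DirichletCharacter.conductor_dvd_of_mem_conductorSet χ hfac
    exact fun h => hd (h.trans hcond)
  · exact fun h => hpm (h.trans χ.conductor_dvd_level)

/-- The primitive case: `p ∤ m`. [cite: Washington1997, Ch. 3 (pp. 19–21)] -/
theorem not_dvd_level_of_isPrimitive_of_forall_mem_inertia {χ : DirichletCharacter ℂ m}
    (hχ : χ.IsPrimitive) {p : ℕ} (hp : p.Prime) {v : HeightOneSpectrum (𝓞 ℚ)}
    (hv : (p : 𝓞 ℚ) ∈ v.asIdeal) {𝔓 : Ideal (absIntegers (𝓞 ℚ) ℚ)} (h𝔓 : 𝔓 ∈ v.primesAbove)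
    (hψ : ∀ τ ∈ 𝔓.inertia (absoluteGaloisGroup ℚ),
      ((dirichletGaloisCharacter ℚ χ τ : ℂˣ) : ℂ) = 1) :
    ¬ p ∣ m := by
  have h := not_dvd_conductor_of_forall_mem_inertia χ hp hv h𝔓 hψ
  rwa [hχ] at h

end Conductor

/-! ### Packaged statement -/

section Package

/-- **Finite-order characters of `Γ_ℚ` unramified at `p` are primitive Dirichlet characters of
conductor prime to `p`.**  Let `ψ : Γ_ℚ → ℂˣ` be a homomorphism with open kernel which is
trivial on the inertia group of some prime `𝔓` of `ℤ̄` above `p`.  Then there are `N ≥ 1` with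
`p ∤ N` and a primitive Dirichlet character `χ` modulo `N` with `ψ(σ) = χ(χ_N(σ))` for every
`σ ∈ Γ_ℚ`; consequently `ψ(Frob_𝔏) = χ(ℓ)` for every prime `ℓ ∤ N`, every prime `𝔏 ∣ ℓ` of `ℤ̄`
and every arithmetic Frobenius `Frob_𝔏`, and `ψ(I_𝔏) = 1`.  This is the identification
"`ε₁, ε₂` can be seen as Dirichlet characters … `N` the conductor of `ρ` … `l ∤ N`" of
Billerey–Menares §2–§3 (there for `\bar 𝔽_l`-valued characters, read in `ℂ` through the
Teichmüller lift). [cite: Washington1997, Ch. 3 (pp. 19–21) and Thm. 14.1; BillereyMenares2018, §3.2] -/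
theorem exists_isPrimitive_dirichletCharacter_of_isOpen_ker (ψ : absoluteGaloisGroup ℚ →* ℂˣ)
    (hker : IsOpen ((ψ.ker : Subgroup (absoluteGaloisGroup ℚ)) : Set (absoluteGaloisGroup ℚ)))
    {p : ℕ} (hp : p.Prime) {v : HeightOneSpectrum (𝓞 ℚ)} (hv : (p : 𝓞 ℚ) ∈ v.asIdeal)
    {𝔓 : Ideal (absIntegers (𝓞 ℚ) ℚ)} (h𝔓 : 𝔓 ∈ v.primesAbove)
    (hψ : ∀ τ ∈ 𝔓.inertia (absoluteGaloisGroup ℚ), ψ τ = 1) :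
    ∃ (N : ℕ) (_ : NeZero N) (χ : DirichletCharacter ℂ N), χ.IsPrimitive ∧ ¬ p ∣ N ∧
      (∀ σ : absoluteGaloisGroup ℚ, (ψ σ : ℂ) = χ (modNCyclotomicCharacter ℚ N σ : ZMod N)) ∧
      (∀ (ℓ : ℕ), ℓ.Prime → ¬ ℓ ∣ N → ∀ w : HeightOneSpectrum (𝓞 ℚ), (ℓ : 𝓞 ℚ) ∈ w.asIdeal →
        ∀ 𝔏 ∈ w.primesAbove, (∀ σ : absoluteGaloisGroup ℚ, IsArithFrobAt (𝓞 ℚ) σ 𝔏 →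
          (ψ σ : ℂ) = χ (ℓ : ZMod N)) ∧
          ∀ τ ∈ 𝔏.inertia (absoluteGaloisGroup ℚ), ψ τ = 1) := by
  obtain ⟨N, hN, χ, hχ, hψχ⟩ :=
    exists_isPrimitive_dirichletCharacter_eq_dirichletGaloisCharacter ψ hker
  have hψ' : ∀ τ ∈ 𝔓.inertia (absoluteGaloisGroup ℚ),
      ((dirichletGaloisCharacter ℚ χ τ : ℂˣ) : ℂ) = 1 := fun τ hτ => by
    rw [← hψχ τ, hψ τ hτ, Units.val_one]
  have hpN : ¬ p ∣ N := not_dvd_level_of_isPrimitive_of_forall_mem_inertia hχ hp hv h𝔓 hψ'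
  refine ⟨N, hN, χ, hχ, hpN, fun σ => ?_, fun ℓ hℓ hℓN w hw 𝔏 h𝔏 => ⟨fun σ hσ => ?_, fun τ hτ => ?_⟩⟩
  · rw [hψχ σ, coe_dirichletGaloisCharacter_apply]
  · have hwℓ : ((primesEquiv w : Nat.Primes) : ℕ) = ℓ := natGenerator_eq_of_natCast_mem_asIdeal hℓ hw
    have h := FramedRep.coe_dirichletGaloisCharacter_of_isArithFrobAt χ h𝔏 (by rw [hwℓ]; exact hℓN) hσ
    rw [hwℓ] at h
    rw [hψχ σ, h]
  · have hwℓ : ((primesEquiv w : Nat.Primes) : ℕ) = ℓ := natGenerator_eq_of_natCast_mem_asIdeal hℓ hw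
    have h := FramedRep.dirichletGaloisCharacter_eq_one_of_mem_inertia χ h𝔏 (by rw [hwℓ]; exact hℓN) hτ
    exact Units.ext (by rw [hψχ τ, h, Units.val_one])

end Package

end Literature.NumberTheory.GaloisRepresentations
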